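import Summits.Ventures.PercRepro2.CaseOneGadgetUWA1OMainII
import Summits.Ventures.PercRepro2.CaseOneGadgetUWA1OMainIIQ
import Summits.Ventures.PercRepro2.CaseOneGadgetUWA1OMainI
import Summits.Ventures.PercRepro2.CaseOneGadgetUWA1OMainIQ
import Summits.Ventures.PercRepro2.CaseOnePendantTreeMarks
import Summits.Ventures.PercRepro2.CaseOneClosedAtIff

/-!
# The gadget `u ~ {w, a₁, o}`, `w ~ {u, a₂, b}` (uwa1o): the closed anchor — all four forms, `(J1₁)`, pendant trees
(blind cell PercRepro2, p1 g34; S5: the fourth gadget anchor of the four-form calculus — the uwa1o row closed on all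
four cells by PLAIN SFacts-cone chains (kits j318477 / j319447, P1-G33 §6′–§6″); own code, on the pattern of
CaseOneGadgetUWA1Anchor / CaseOneGadgetUWOAnchor)

With the four chain heads `zSplitII_of_gadgetUWA1O` / `zSplitIIQ_of_gadgetUWA1O` / `zSplitI_of_gadgetUWA1O` /
`zSplitIQ_of_gadgetUWA1O` (CaseOneGadgetUWA1OMain*), a uwa1o-gadget vertex has **all four forms for every finite graph
and every weight vector** (`fourForms_of_gadgetUWA1O`), hence `(J1₁)` there (`jOneOne_of_gadgetUWA1O`, K1); it is a
closed anchor in the sense of the pendant-tree closure (`GadgetUWA1OAnchor`, `fourFormsAll_of_gadgetUWA1OAnchor`): every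
vertex of every pendant tree hanging at a uwa1o-gadget vertex has the four forms, `(J1₁)` and — where `P(T′) > 0` —
`(RV)` (`fourForms_of_pendantTree_gadgetUWA1O`, `jOneOne_of_pendantTree_gadgetUWA1O`, `rv_of_pendantTree_gadgetUWA1O`),
and every instance reachable from a uwa1o-gadget vertex by the moves of CaseOneMoves is closed
(`closedAt_of_gadgetUWA1OAnchor`, `closedAt_of_moves_gadgetUWA1O`, `fourForms_of_moves_gadgetUWA1O`). The uwa1o shape
is not symmetric in the roots (`u ~ a₁`, `w ~ a₂`), so no `(J1)` (which needs the mirror shape) is claimed.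
Standard axioms. -/

namespace Summit.Ventures.PercRepro2

namespace CaseOne

universe u

section Vertex
variable {V : Type*} {E : Type*} [Fintype E] [DecidableEq E] [Fintype V] [DecidableEq V]
  {R : Type*} [Field R] [LinearOrder R] [IsStrictOrderedRing R]
variable {ends : E → Sym2 V} {o a₁ a₂ b u w : V} {euw eua1 euo ewa2 ewb : E}

/-- **All four forms at a uwa1o-gadget vertex**, every finite graph, every weight vector. -/
theorem fourForms_of_gadgetUWA1O (p : E → R) (hp : IsProbVec p)
    (h : IsGadgetUWA1O ends o a₁ a₂ b u w euw eua1 euo ewa2 ewb) : FourForms p ends o a₁ a₂ u b :=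
  ⟨zSplitII_of_gadgetUWA1O p hp h, zSplitIIQ_of_gadgetUWA1O p hp h, zSplitI_of_gadgetUWA1O p hp h,
    zSplitIQ_of_gadgetUWA1O p hp h⟩

/-- **`(J1₁)` at a uwa1o-gadget vertex** (K1: `(i)` and `(ii)` give `(J1₁)`). -/
theorem jOneOne_of_gadgetUWA1O (p : E → R) (hp : IsProbVec p)
    (h : IsGadgetUWA1O ends o a₁ a₂ b u w euw eua1 euo ewa2 ewb) : JOneOne p ends o a₁ a₂ u b :=
  jOneOne_of_i_of_ii p ends o a₁ a₂ u b (zSplitI_of_gadgetUWA1O p hp h) (zSplitII_of_gadgetUWA1O p hp h)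

end Vertex

section AnchorDef
variable {V : Type*}

/-- The uwa1o-gadget anchor: `v ~ {w, a₁, o}` with `w ~ {v, a₂, b}` for some unmarked `w`. -/
def GadgetUWA1OAnchor (o a₁ a₂ b : V) (E : Type u) (ends : E → Sym2 V) (v : V) : Prop :=
  ∃ (w : V) (euw eua1 euo ewa2 ewb : E), IsGadgetUWA1O ends o a₁ a₂ b v w euw eua1 euo ewa2 ewb

end AnchorDef

section Anchor
variable {V : Type*} [Fintype V] [DecidableEq V] {R : Type*} [Field R] [LinearOrder R]
  [IsStrictOrderedRing R]

variable (o a₁ a₂ b : V)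

/-- A uwa1o-gadget anchor has the four forms. -/
theorem fourForms_of_gadgetUWA1OAnchor (E : Type u) [Fintype E] [DecidableEq E] (ends : E → Sym2 V)
    (p : E → R) (hp : IsProbVec p) (v : V) (h : GadgetUWA1OAnchor o a₁ a₂ b E ends v) :
    FourForms p ends o a₁ a₂ v b := by
  obtain ⟨w, euw, eua1, euo, ewa2, ewb, h⟩ := h
  exact fourForms_of_gadgetUWA1O p hp h

/-- A uwa1o-gadget anchor is closed for every weight vector: `FourFormsAll`. -/
theorem fourFormsAll_of_gadgetUWA1OAnchor (E : Type u) [Fintype E] [DecidableEq E] (ends : E → Sym2 V)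
    (v : V) (h : GadgetUWA1OAnchor o a₁ a₂ b E ends v) : FourFormsAll R o a₁ a₂ b E ends v := by
  intro _ _ p hp
  exact fourForms_of_gadgetUWA1OAnchor o a₁ a₂ b E ends p hp v h

/-- A uwa1o-gadget anchor is closed: `ClosedAt`. -/
theorem closedAt_of_gadgetUWA1OAnchor (E : Type u) [Fintype E] [DecidableEq E] (ends : E → Sym2 V)
    (v : V) (h : GadgetUWA1OAnchor o a₁ a₂ b E ends v) : ClosedAt R o a₁ a₂ b E ends v :=
  fun p hp => fourForms_of_gadgetUWA1OAnchor o a₁ a₂ b E ends p hp v h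

/-- **Every instance reachable by moves from a uwa1o-gadget vertex is closed.** -/
theorem closedAt_of_moves_gadgetUWA1O {E' : Type u} [Fintype E'] [DecidableEq E'] {ends' : E' → Sym2 V}
    {v' : V} (h' : GadgetUWA1OAnchor o a₁ a₂ b E' ends' v') {E : Type u} [Fintype E] [DecidableEq E]
    {ends : E → Sym2 V} {v : V} (h : Moves o a₁ a₂ b E' ends' v' E ends v) :
    ClosedAt R o a₁ a₂ b E ends v :=
  closedAt_of_moves h (closedAt_of_gadgetUWA1OAnchor o a₁ a₂ b E' ends' v' h')

/-- The four forms for one weight vector on every instance reachable by moves from a uwa1o-gadget vertex. -/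
theorem fourForms_of_moves_gadgetUWA1O {E' : Type u} [Fintype E'] [DecidableEq E'] {ends' : E' → Sym2 V}
    {v' : V} (h' : GadgetUWA1OAnchor o a₁ a₂ b E' ends' v') {E : Type u} [Fintype E] [DecidableEq E]
    {ends : E → Sym2 V} {v : V} (h : Moves o a₁ a₂ b E' ends' v' E ends v) (p : E → R)
    (hp : IsProbVec p) : FourForms p ends o a₁ a₂ v b :=
  closedAt_of_moves_gadgetUWA1O o a₁ a₂ b h' h p hp

variable {E : Type u} [Fintype E] [DecidableEq E] {ends : E → Sym2 V} {v a₃ y : V} {S : Set V} {n : ℕ}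

/-- **The four forms at the end of a pendant path of any length at a uwa1o-gadget vertex**, every finite
graph, every weight vector. -/
theorem fourForms_of_pendantPath_gadgetUWA1O (p : E → R) (hp : IsProbVec p)
    (h : IsPendantPathAt (GadgetUWA1OAnchor o a₁ a₂ b) o a₁ a₂ b n E ends v a₃) :
    FourForms p ends o a₁ a₂ a₃ b :=
  fourForms_of_pendantPath (GadgetUWA1OAnchor o a₁ a₂ b) o a₁ a₂ b
    (fourForms_of_gadgetUWA1OAnchor o a₁ a₂ b) n E ends p hp v a₃ h

/-- **`(RV)` at the end of a pendant path of any length at a uwa1o-gadget vertex** (where `P(T′) > 0`). -/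
theorem rv_of_pendantPath_gadgetUWA1O (p : E → R) (hp : IsProbVec p)
    (h : IsPendantPathAt (GadgetUWA1OAnchor o a₁ a₂ b) o a₁ a₂ b n E ends v a₃)
    (hT : 0 < prob p (Tp ends a₁ a₂ a₃)) : RV p ends o a₁ a₂ a₃ b :=
  rv_of_pendantPath (GadgetUWA1OAnchor o a₁ a₂ b) (fourForms_of_gadgetUWA1OAnchor o a₁ a₂ b) p hp h hT

/-- **The four forms at every vertex of every pendant tree hanging at a uwa1o-gadget vertex**, every finite
graph, every weight vector. -/
theorem fourForms_of_pendantTree_gadgetUWA1O (p : E → R) (hp : IsProbVec p)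
    (h : IsPendantTreeAt (GadgetUWA1OAnchor o a₁ a₂ b) o a₁ a₂ b n E ends v S) (hy : y ∈ S) :
    FourForms p ends o a₁ a₂ y b :=
  fourForms_of_pendantTree (GadgetUWA1OAnchor o a₁ a₂ b) o a₁ a₂ b
    (fourForms_of_gadgetUWA1OAnchor o a₁ a₂ b) n E ends p hp v S h y hy

/-- **`(J1₁)` at every vertex of every pendant tree hanging at a uwa1o-gadget vertex.** -/
theorem jOneOne_of_pendantTree_gadgetUWA1O (p : E → R) (hp : IsProbVec p)
    (h : IsPendantTreeAt (GadgetUWA1OAnchor o a₁ a₂ b) o a₁ a₂ b n E ends v S) (hy : y ∈ S) :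
    JOneOne p ends o a₁ a₂ y b :=
  jOneOne_of_i_of_ii p ends o a₁ a₂ y b (fourForms_of_pendantTree_gadgetUWA1O o a₁ a₂ b p hp h hy).2.2.1
    (fourForms_of_pendantTree_gadgetUWA1O o a₁ a₂ b p hp h hy).1

/-- **`(RV)` at every vertex of every pendant tree hanging at a uwa1o-gadget vertex** (where `P(T′) > 0`). -/
theorem rv_of_pendantTree_gadgetUWA1O (p : E → R) (hp : IsProbVec p)
    (h : IsPendantTreeAt (GadgetUWA1OAnchor o a₁ a₂ b) o a₁ a₂ b n E ends v S) (hy : y ∈ S)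
    (hT : 0 < prob p (Tp ends a₁ a₂ y)) : RV p ends o a₁ a₂ y b :=
  rv_of_pendantTree (GadgetUWA1OAnchor o a₁ a₂ b) (fourForms_of_gadgetUWA1OAnchor o a₁ a₂ b) p hp h hy hT

end Anchor

end CaseOne

end Summit.Ventures.PercRepro2
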